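/-
Copyright (c) 2026 The HCML crux team. All rights reserved.
Released under Apache 2.0 license as described in the file LICENSE.
Authors: K2E3-p23 (g5) (explicit-unit `hodgecm-mathlib-K2E3-p23-g5`)
-/
import Summits.HodgeConjecture.HodgeConjecture.Theorems.K2E3GL3ModCocompactCentral       -- ★ (B0a) p857674: frame (`Valued`/`ValuativeRel` bridge ★, `G_Λ`)
import Literature.NumberTheory.Automorphic.TateLocalFactorsProofs                      -- ★ `isCompact_units_valuation_eq_one`, `isOpen_units_valuation_eq_one`
import Mathlib.Topology.Algebra.IsUniformGroup.Basic
import HarnessLib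

/-!
# (GL-[M6]-sc, B0z) `Λ = ϖ^ℤ` is a closed, discrete, cocompact subgroup of `F^×`

Cell `hodgecm-mathlib`, Track B, line `K2_E3_EllipticInputs`; payer «GL-[M6]-sc» of leaf (11-3-split-sc) (dealer K2E3-plan (g3) D63, line lead K2E3-p23 (g5);
RULINGS #5 (M5-2) «Λ₀ := zpowers ϖ»).  The bricks ★ B0a ∕ B0a-U ∕ B1 ∕ B3 ∕ B6-core of the road are typed for any subgroup `Λ₀ ≤ F^×` with
`hΛ : IsClosed Λ₀` and `[CompactSpace (F^× ⧸ Λ₀)]`; the transport `GL₃(F) → GL₃(F) ⧸ ϖ^ℤ·1` (B0b, B0c) uses `Λ₀ := zpowers ϖ`.  This file discharges the two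
side conditions for that choice:

* §1 `v_units_zpow_uniformizer` (`|ϖ^n| = exp(−n)`), **`discreteTopology_zpowers_uniformizer`** (`{1} = ϖ^ℤ ∩ 𝒪^×` is open in `ϖ^ℤ`),
  **`isClosed_zpowers_uniformizer`** (a discrete subgroup of a Hausdorff group is closed, Mathlib `Subgroup.isClosed_of_discrete`).
* §2 **`compactSpace_units_quot_zpowers_uniformizer`** — `F^× ⧸ ϖ^ℤ` is compact: it is the image of the compact unit group `𝒪^× = {|x| = 1}` ★
  (`x ↦ x·ϖ^{log|x|}` lands in `𝒪^×`).

HONEST LABEL: HC_CM is proved only modulo the 7 printed citations (2 remaining named inputs: hLiu418 = stmt-HodgeConjecture-24832, h413 =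
stmt-HodgeConjecture-24833) until rung 0 closes; structure theory, count-neutral (kernel lane `--supports stmt-HodgeConjecture-24833 --as helper`), THEOREMS ONLY.

References: Cassels–Fröhlich, *Algebraic Number Theory*, Ch. II §§1–2 (`F^× ≅ ϖ^ℤ × 𝒪^×`, `𝒪^×` compact open) [cite: CasselsFrohlich1967, Ch. II §2];
Platonov–Rapinchuk 1994 §3.3 [cite: PlatonovRapinchuk1994, §3.3].
-/

open MeasureTheory Set Function Filter
open scoped MatrixGroups Pointwise WithZero Valued Topology
open ValuativeRel
open Literature.NumberTheory.Automorphic Literature.NumberTheory.GaloisRepresentations Literature.NumberTheory.GaloisRepresentations.IsNonarchimedeanLocalField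

set_option linter.dupNamespace false

namespace Summit.HodgeConjecture.HodgeConjecture.Cruxes.H413.K2E3GL3ModUniformizerCocompact

variable {F : Type*} [Field F] [Valued F ℤᵐ⁰] [ValuativeRel F] [(Valued.v : Valuation F ℤᵐ⁰).Compatible] [IsNonarchimedeanLocalField F]

/-! ## §1 `ϖ^ℤ` is discrete and closed in `F^×` -/

omit [ValuativeRel F] [(Valued.v : Valuation F ℤᵐ⁰).Compatible] [IsNonarchimedeanLocalField F] in
/-- `|ϖ^n| = exp(−n)` for the unit `ϖ ∈ F^×`. [cite: CasselsFrohlich1967, Ch. II §2] -/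
theorem v_units_zpow_uniformizer {ϖ : F} (hϖ : Valued.v ϖ = WithZero.exp (-1 : ℤ)) (hϖ0 : ϖ ≠ 0) (n : ℤ) : Valued.v ((((Units.mk0 ϖ hϖ0) ^ n : Fˣ)) : F) = WithZero.exp (-n) := by
  rw [Units.val_zpow_eq_zpow_val, Units.val_mk0, map_zpow₀, hϖ, ← WithZero.exp_zsmul, smul_eq_mul, mul_neg, mul_one]

/-- **`ϖ^ℤ ≤ F^×` is discrete**: `ϖ^n ∈ 𝒪^× ⇔ n = 0`, and `𝒪^× = {|x| = 1}` is open in `F^×` ★. [cite: CasselsFrohlich1967, Ch. II §2] -/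
theorem discreteTopology_zpowers_uniformizer {ϖ : F} (hϖ : Valued.v ϖ = WithZero.exp (-1 : ℤ)) (hϖ0 : ϖ ≠ 0) :
    DiscreteTopology ↥(Subgroup.zpowers (Units.mk0 ϖ hϖ0)) := by
  refine discreteTopology_of_isOpen_singleton_one ?_
  have h : ({1} : Set ↥(Subgroup.zpowers (Units.mk0 ϖ hϖ0))) = Subtype.val ⁻¹' {x : Fˣ | valuation F (x : F) = 1} := by
    ext ⟨x, hx⟩
    simp only [Set.mem_singleton_iff, Set.mem_preimage, Set.mem_setOf_eq]
    obtain ⟨n, rfl⟩ := Subgroup.mem_zpowers_iff.1 hx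
    rw [← v_eq_one_iff_valuation_eq_one, v_units_zpow_uniformizer hϖ hϖ0, WithZero.exp_eq_one, neg_eq_zero]
    constructor
    · intro h1
      have h2 : ((Units.mk0 ϖ hϖ0) ^ n : Fˣ) = 1 := congrArg Subtype.val h1
      have h3 : Valued.v ((((Units.mk0 ϖ hϖ0) ^ n : Fˣ)) : F) = Valued.v (((1 : Fˣ)) : F) := by rw [h2]
      rw [v_units_zpow_uniformizer hϖ hϖ0, Units.val_one, map_one, WithZero.exp_eq_one, neg_eq_zero] at h3
      exact h3
    · rintro rfl
      exact Subtype.ext (zpow_zero _)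
  rw [h]
  exact isOpen_units_valuation_eq_one.preimage continuous_subtype_val

/-- **`ϖ^ℤ` is closed in `F^×`** (discrete subgroups of Hausdorff groups are closed). [cite: CasselsFrohlich1967, Ch. II §2] -/
theorem isClosed_zpowers_uniformizer {ϖ : F} (hϖ : Valued.v ϖ = WithZero.exp (-1 : ℤ)) (hϖ0 : ϖ ≠ 0) :
    IsClosed ((Subgroup.zpowers (Units.mk0 ϖ hϖ0) : Subgroup Fˣ) : Set Fˣ) := by
  haveI : IsTopologicalRing F := inferInstance
  haveI : T2Space F := (isLocalField F).toT2Space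
  haveI : DiscreteTopology ↥(Subgroup.zpowers (Units.mk0 ϖ hϖ0)) := discreteTopology_zpowers_uniformizer hϖ hϖ0
  exact Subgroup.isClosed_of_discrete

/-! ## §2 `F^× ⧸ ϖ^ℤ` is compact -/

omit [IsNonarchimedeanLocalField F] in
/-- Every class of `F^× ⧸ ϖ^ℤ` has a representative in `𝒪^×`: `x · ϖ^{log|x|} ∈ 𝒪^×`. [cite: CasselsFrohlich1967, Ch. II §2] -/
theorem image_mk_units_valuation_eq_one_eq_univ {ϖ : F} (hϖ : Valued.v ϖ = WithZero.exp (-1 : ℤ)) (hϖ0 : ϖ ≠ 0) :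
    (QuotientGroup.mk : Fˣ → Fˣ ⧸ Subgroup.zpowers (Units.mk0 ϖ hϖ0)) '' {x : Fˣ | valuation F (x : F) = 1} = Set.univ := by
  refine Set.eq_univ_of_forall fun q => ?_
  obtain ⟨x, rfl⟩ := QuotientGroup.mk_surjective q
  have hx0 : Valued.v (x : F) ≠ 0 := (Valuation.ne_zero_iff Valued.v).2 x.ne_zero
  have hvx : Valued.v (x : F) = WithZero.exp (WithZero.log (Valued.v (x : F))) := (WithZero.exp_log hx0).symm
  refine ⟨x * (Units.mk0 ϖ hϖ0) ^ WithZero.log (Valued.v (x : F)), ?_, ?_⟩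
  · show valuation F (((x * (Units.mk0 ϖ hϖ0) ^ WithZero.log (Valued.v (x : F)) : Fˣ)) : F) = 1
    rw [← v_eq_one_iff_valuation_eq_one, Units.val_mul, map_mul, v_units_zpow_uniformizer hϖ hϖ0, hvx, ← WithZero.exp_add, WithZero.log_exp,
      add_neg_cancel, WithZero.exp_zero]
  · refine QuotientGroup.eq.2 ?_
    rw [mul_inv_rev, inv_mul_cancel_right]
    exact inv_mem (Subgroup.zpow_mem_zpowers _ _)

/-- **`F^× ⧸ ϖ^ℤ` IS COMPACT** — the continuous image of the compact `𝒪^×` ★ `isCompact_units_valuation_eq_one`. [cite: CasselsFrohlich1967, Ch. II §2] -/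
theorem compactSpace_units_quot_zpowers_uniformizer {ϖ : F} (hϖ : Valued.v ϖ = WithZero.exp (-1 : ℤ)) (hϖ0 : ϖ ≠ 0) :
    CompactSpace (Fˣ ⧸ Subgroup.zpowers (Units.mk0 ϖ hϖ0)) := by
  refine ⟨?_⟩
  rw [← image_mk_units_valuation_eq_one_eq_univ hϖ hϖ0]
  exact isCompact_units_valuation_eq_one.image QuotientGroup.continuous_mk

end Summit.HodgeConjecture.HodgeConjecture.Cruxes.H413.K2E3GL3ModUniformizerCocompact
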